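import Summits.KontsevichZagierPeriods.KontsevichZagierPeriods.Theses.HurwitzMicroSectors
import Summits.KontsevichZagierPeriods.KontsevichZagierPeriods.Theorems.HurwitzMicroSectorsNormalFormPrinciplePiBoxTransfer
import Summits.KontsevichZagierPeriods.KontsevichZagierPeriods.Theorems.HurwitzMicroSectorsNormalFormPrincipleVariants2340
import Summits.KontsevichZagierPeriods.KontsevichZagierPeriods.Theorems.HurwitzMicroSectorsNormalFormPrincipleVariants2223
import Summits.KontsevichZagierPeriods.KontsevichZagierPeriods.Theorems.HurwitzMicroSectorsNormalFormPrincipleVariants2222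

/-! TTRL-lite variant V2254 of stmt-KontsevichZagierPeriods-3869

Variant V2254 = `stub_boxRigidity` (BoxRigidity: two box-rational representations — domain the open
unit box `(0,1)^m`, integrand `p/q`, `p, q ∈ ℚ[x]`, `q ≠ 0` on the box — with equal values are
KZ-equivalent) under the JOINT small-case move `bound_nat:m≤3; bound_nat:m'≤5` (hypotheses in the
order `m' ≤ 5 → m ≤ 3`). Verdict of the attempt seat: **open** — this file is the exact-strength
certificate, not a proof of the variant:

* `stub_boxRigidity_var2254_iff_boxVanishingLe`: V2254 ⟺ BoxVanishing(dim ≤ 5) — every box-rational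
  representation on `(0,1)^m`, `m ≤ 5`, of value `0` is a relation (instance `j = 3, k = 5` of the
  tree's `boxRigidityLe_iff_boxVanishingLe`, file `…Variants2340`);
* `stub_boxRigidity_var2254_iff_le_five`: the bound `m ≤ 3` is idle next to `m' ≤ 5` —
  V2254 ⟺ BoxRigidity(m, m' ≤ 5); hence `stub_boxRigidity_var2254_iff_var2223` (V2254 ⟺ the sibling
  V2223, `m ≤ 2, m' ≤ 5`) and `stub_boxRigidity_var2254_iff_boxVanishing_five` (V2254 ⟺ BoxVanishing in
  the single dimension `5`, through `…Variants2222`): raising the idle bound from `2` to `3` changes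
  nothing;
* `stub_boxRigidity_var2254_iff_boxVanishing_two_le_five`: since BoxVanishing(dim ≤ 1) is a THEOREM of
  the tree (Baker, `boxVanishingLe_one`), the variant is exactly Conjecture 1 for all box-rational
  periods of dimensions `2, 3, 4, 5` — among them every `ℚ`-linear relation among `1, π², G` (Catalan),
  `ζ(3)`, `ζ(5)`, `ζ(2)ζ(3)`, decided in favour of the four moves; no proof and no refutation exists;
* `stub_boxRigidity_var2254_of_statement`: `KontsevichZagierPeriods → V2254`, so a refutation of the
  variant would refute the Summit (and `relations_le_ker_eval_holds` is the only proved constraint on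
  `relations`, so no invariant separating equal-valued representations is available).

Source: M. Kontsevich, D. Zagier, *Periods* (2001), §1.2 Conjecture 1 and rules 1)–3); A. Baker,
*Transcendental Number Theory* (1975), Thm. 2.1 (the proved rung). Pure proof file, no definitions. -/

-- `Summit.<Summit>.<Problem>` is the tree's mandated summit-side namespace (CONVENTIONS §2); for this
-- single-conjunct summit the two coincide, so the duplicate is deliberate.
set_option linter.dupNamespace false

noncomputable section

namespace Summit.KontsevichZagierPeriods.KontsevichZagierPeriods.Theorems

open MeasureTheory Set
open Literature.NumberTheory.Transcendental Literature.NumberTheory.Transcendental.KZ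
open Summit.KontsevichZagierPeriods.KontsevichZagierPeriods.Theses.HurwitzMicroSectors
open Summit.KontsevichZagierPeriods.HurwitzMicroSectors.NormalFormPrinciple.PiBox

/-! ## The variant V2254: Conjecture 1 for box-rational periods of dimension `≤ 5` -/

/-- **V2254 with its hypotheses in the standard order**: `m' ≤ 5 → m ≤ 3 → …` is
`BoxRigidity(m ≤ 3, m' ≤ 5)`. [cite: KontsevichZagier2001, §1.2 Conjecture 1] -/
theorem stub_boxRigidity_var2254_iff_swap :
    (∀ (m m' : ℕ) (N : IntegralRep m) (N' : IntegralRep m'), m' ≤ 5 → m ≤ 3 → N.domain = {x | ∀ i, x i ∈ Set.Ioo (0:ℝ) 1} → N.IsRational → N'.domain = {x | ∀ i, x i ∈ Set.Ioo (0:ℝ) 1} → N'.IsRational → N.value = N'.value → Equivalent N N') ↔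
    (∀ (m m' : ℕ) (N : IntegralRep m) (N' : IntegralRep m'), m ≤ 3 → m' ≤ 5 →
      N.domain = {x | ∀ i, x i ∈ Set.Ioo (0:ℝ) 1} → N.IsRational →
      N'.domain = {x | ∀ i, x i ∈ Set.Ioo (0:ℝ) 1} → N'.IsRational →
      N.value = N'.value → Equivalent N N') :=
  ⟨fun h m m' N N' hm hm' => h m m' N N' hm' hm, fun h m m' N N' hm' hm => h m m' N N' hm hm'⟩

/-- **V2254 ⟺ BoxVanishing(dim ≤ 5)**: the variant is exactly "every representation on `(0,1)^m`,
`m ≤ 5`, with integrand of KZ's rational shape over `ℚ` and value `0` is a KZ relation" — Conjecture 1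
for all box-rational periods of dimension `≤ 5`, open (instance `j = 3`, `k = 5` of the
joint-bound equivalence: compare with the zero representation one way, pad to the common `5`-box and
subtract the integrands the other way). [cite: KontsevichZagier2001, §1.2 Conjecture 1] -/
theorem stub_boxRigidity_var2254_iff_boxVanishingLe :
    (∀ (m m' : ℕ) (N : IntegralRep m) (N' : IntegralRep m'), m' ≤ 5 → m ≤ 3 → N.domain = {x | ∀ i, x i ∈ Set.Ioo (0:ℝ) 1} → N.IsRational → N'.domain = {x | ∀ i, x i ∈ Set.Ioo (0:ℝ) 1} → N'.IsRational → N.value = N'.value → Equivalent N N') ↔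
    (∀ (m : ℕ) (N : IntegralRep m), m ≤ 5 → N.domain = {x | ∀ i, x i ∈ Set.Ioo (0:ℝ) 1} →
      N.IsRational → N.value = 0 → of N ∈ relations) := by
  rw [stub_boxRigidity_var2254_iff_swap]
  exact ⟨fun h m N hm => boxVanishingLe_of_boxRigidityLe 3 5 h m N (hm.trans (le_max_right 3 5)),
    fun h => boxRigidityLe_of_boxVanishingLe 3 5 5 (max_le (by norm_num) le_rfl) h⟩

/-- **V2254 ⟺ BoxRigidity(m, m' ≤ 5)**: the bound `m ≤ 3` is idle next to `m' ≤ 5` (a joint bound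
is worth BoxVanishing up to the LARGER bound), and the variant is symmetric in the two slots.
[cite: KontsevichZagier2001, §1.2 Conjecture 1] -/
theorem stub_boxRigidity_var2254_iff_le_five :
    (∀ (m m' : ℕ) (N : IntegralRep m) (N' : IntegralRep m'), m' ≤ 5 → m ≤ 3 → N.domain = {x | ∀ i, x i ∈ Set.Ioo (0:ℝ) 1} → N.IsRational → N'.domain = {x | ∀ i, x i ∈ Set.Ioo (0:ℝ) 1} → N'.IsRational → N.value = N'.value → Equivalent N N') ↔
    (∀ (m m' : ℕ) (N : IntegralRep m) (N' : IntegralRep m'), m ≤ 5 → m' ≤ 5 →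
      N.domain = {x | ∀ i, x i ∈ Set.Ioo (0:ℝ) 1} → N.IsRational →
      N'.domain = {x | ∀ i, x i ∈ Set.Ioo (0:ℝ) 1} → N'.IsRational →
      N.value = N'.value → Equivalent N N') := by
  rw [stub_boxRigidity_var2254_iff_boxVanishingLe, boxRigidityLe_iff_boxVanishingLe, max_self]

/-- **V2254 ⟺ V2223** (the sibling `bound_nat:m≤2; bound_nat:m'≤5`): both are BoxVanishing(dim ≤ 5);
raising the idle bound on `m` from `2` to `3` changes nothing. [cite: KontsevichZagier2001, §1.2 Conjecture 1] -/
theorem stub_boxRigidity_var2254_iff_var2223 :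
    (∀ (m m' : ℕ) (N : IntegralRep m) (N' : IntegralRep m'), m' ≤ 5 → m ≤ 3 → N.domain = {x | ∀ i, x i ∈ Set.Ioo (0:ℝ) 1} → N.IsRational → N'.domain = {x | ∀ i, x i ∈ Set.Ioo (0:ℝ) 1} → N'.IsRational → N.value = N'.value → Equivalent N N') ↔
    (∀ (m m' : ℕ) (N : IntegralRep m) (N' : IntegralRep m'), m' ≤ 5 → m ≤ 2 → N.domain = {x | ∀ i, x i ∈ Set.Ioo (0:ℝ) 1} → N.IsRational → N'.domain = {x | ∀ i, x i ∈ Set.Ioo (0:ℝ) 1} → N'.IsRational → N.value = N'.value → Equivalent N N') := by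
  rw [stub_boxRigidity_var2254_iff_boxVanishingLe, stub_boxRigidity_var2223_iff_boxVanishingLe]

/-- **V2254 ⟺ `BoxVanishing 5`** (the single dimension `5`: lower dimensions pad into the `5`-box),
through the sibling V2222 (`…_iff_le_five`, `…_iff_boxVanishing_five` of file `…Variants2222`).
[cite: KontsevichZagier2001, §1.2 Conjecture 1] -/
theorem stub_boxRigidity_var2254_iff_boxVanishing_five :
    (∀ (m m' : ℕ) (N : IntegralRep m) (N' : IntegralRep m'), m' ≤ 5 → m ≤ 3 → N.domain = {x | ∀ i, x i ∈ Set.Ioo (0:ℝ) 1} → N.IsRational → N'.domain = {x | ∀ i, x i ∈ Set.Ioo (0:ℝ) 1} → N'.IsRational → N.value = N'.value → Equivalent N N') ↔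
    (∀ (M : IntegralRep 5), M.domain = {x | ∀ i, x i ∈ Set.Ioo (0:ℝ) 1} → M.IsRational →
      M.value = 0 → of M ∈ relations) := by
  rw [stub_boxRigidity_var2254_iff_le_five, ← stub_boxRigidity_var2222_iff_le_five,
    stub_boxRigidity_var2222_iff_boxVanishing_five]

/-- **The residual is exactly dimensions `2` to `5`**: BoxVanishing(dim ≤ 1) is a theorem of the tree
(`boxVanishingLe_one`: Baker's theorem on linear forms in logarithms through `boxRigidity_of_le_one`),
so V2254 ⟺ "every box-rational representation on `(0,1)^m`, `2 ≤ m ≤ 5`, of value `0` is a relation".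
[cite: KontsevichZagier2001, §1.2 Conjecture 1] -/
theorem stub_boxRigidity_var2254_iff_boxVanishing_two_le_five :
    (∀ (m m' : ℕ) (N : IntegralRep m) (N' : IntegralRep m'), m' ≤ 5 → m ≤ 3 → N.domain = {x | ∀ i, x i ∈ Set.Ioo (0:ℝ) 1} → N.IsRational → N'.domain = {x | ∀ i, x i ∈ Set.Ioo (0:ℝ) 1} → N'.IsRational → N.value = N'.value → Equivalent N N') ↔
    (∀ (m : ℕ) (N : IntegralRep m), 2 ≤ m → m ≤ 5 → N.domain = {x | ∀ i, x i ∈ Set.Ioo (0:ℝ) 1} →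
      N.IsRational → N.value = 0 → of N ∈ relations) := by
  rw [stub_boxRigidity_var2254_iff_var2223, stub_boxRigidity_var2223_iff_boxVanishing_two_le_five]

/-- **V2254 ⇒ BoxVanishing in dimension `3`** (the variant's own diagonal `m = 3`: for every `c : ℚ` it
contains the instance `ζ(3) = c → [(0,1)³, 1/(1−xyz) − c] ∈ relations`; here the rigidity input
`ζ(3) ∉ ℚ` IS a theorem, but the layer also holds every other box-rational period of `(0,1)³`).
[cite: KontsevichZagier2001, §1.2 Conjecture 1] -/
theorem boxVanishing_three_of_stub_boxRigidity_var2254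
    (h : ∀ (m m' : ℕ) (N : IntegralRep m) (N' : IntegralRep m'), m' ≤ 5 → m ≤ 3 → N.domain = {x | ∀ i, x i ∈ Set.Ioo (0:ℝ) 1} → N.IsRational → N'.domain = {x | ∀ i, x i ∈ Set.Ioo (0:ℝ) 1} → N'.IsRational → N.value = N'.value → Equivalent N N')
    (N : IntegralRep 3) (hNd : N.domain = {x | ∀ i, x i ∈ Set.Ioo (0:ℝ) 1}) (hNr : N.IsRational)
    (hv : N.value = 0) : of N ∈ relations :=
  stub_boxRigidity_var2254_iff_boxVanishingLe.1 h 3 N (by norm_num) hNd hNr hv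

/-- **`KontsevichZagierPeriods ⇒ V2254`**: the variant is a special case of Conjecture 1 for the
tree's calculus (`leaves_of_statement`) — a refutation of the variant would refute the Summit.
[cite: KontsevichZagier2001, §1.2 Conjecture 1] -/
theorem stub_boxRigidity_var2254_of_statement (h : _root_.KontsevichZagierPeriods) :
    ∀ (m m' : ℕ) (N : IntegralRep m) (N' : IntegralRep m'), m' ≤ 5 → m ≤ 3 → N.domain = {x | ∀ i, x i ∈ Set.Ioo (0:ℝ) 1} → N.IsRational → N'.domain = {x | ∀ i, x i ∈ Set.Ioo (0:ℝ) 1} → N'.IsRational → N.value = N'.value → Equivalent N N' :=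
  fun m m' N N' _ _ => (leaves_of_statement h).1 m m' N N'

/-- **The parent leaf ⇒ V2254** (the variant is a specialisation of `stub_boxRigidity`; the converse
is not claimed — the parent is BoxVanishing in ALL dimensions, `boxRigidity_iff_forall_boxVanishingLe`).
[cite: KontsevichZagier2001, §1.2 Conjecture 1] -/
theorem stub_boxRigidity_var2254_of_parent
    (h : ∀ (m m' : ℕ) (N : IntegralRep m) (N' : IntegralRep m'), N.domain = {x | ∀ i, x i ∈ Set.Ioo (0:ℝ) 1} → N.IsRational → N'.domain = {x | ∀ i, x i ∈ Set.Ioo (0:ℝ) 1} → N'.IsRational → N.value = N'.value → Equivalent N N') :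
    ∀ (m m' : ℕ) (N : IntegralRep m) (N' : IntegralRep m'), m' ≤ 5 → m ≤ 3 → N.domain = {x | ∀ i, x i ∈ Set.Ioo (0:ℝ) 1} → N.IsRational → N'.domain = {x | ∀ i, x i ∈ Set.Ioo (0:ℝ) 1} → N'.IsRational → N.value = N'.value → Equivalent N N' :=
  fun m m' N N' _ _ => h m m' N N'

/-- **The proved rung next to V2254**: the same statement with the bounds lowered to `m' ≤ 1`, `m ≤ 1`
(in V2254's hypothesis order) holds outright (`boxRigidityLe_of_max_le_one`, Baker) — the joint
small-case move reaches a theorem only at `max ≤ 1`, never at `max = 5`; and already the bound pair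
`(m' ≤ 1, m ≤ 3)` is open (it is BoxVanishing(dim ≤ 3), file `…Variants2340`).
[cite: KontsevichZagier2001, §1.2 Conjecture 1] -/
theorem stub_boxRigidity_var2254_rung_one_three_iff_boxVanishingLe_three :
    (∀ (m m' : ℕ) (N : IntegralRep m) (N' : IntegralRep m'), m' ≤ 1 → m ≤ 3 →
      N.domain = {x | ∀ i, x i ∈ Set.Ioo (0:ℝ) 1} → N.IsRational →
      N'.domain = {x | ∀ i, x i ∈ Set.Ioo (0:ℝ) 1} → N'.IsRational →
      N.value = N'.value → Equivalent N N') ↔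
    (∀ (m : ℕ) (N : IntegralRep m), m ≤ 3 → N.domain = {x | ∀ i, x i ∈ Set.Ioo (0:ℝ) 1} →
      N.IsRational → N.value = 0 → of N ∈ relations) := by
  have e := boxRigidityLe_iff_boxVanishingLe 3 1
  rw [show max 3 1 = 3 from rfl] at e
  exact ⟨fun h => e.1 fun m m' N N' hm hm' => h m m' N N' hm' hm,
    fun h m m' N N' hm' hm => e.2 h m m' N N' hm hm'⟩

end Summit.KontsevichZagierPeriods.KontsevichZagierPeriods.Theorems
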